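import Summits.AnomalousDissipation.AnomalousDissipation.Theorems.SawtoothPulseCascadeK1LocalisedCascadeDyadicStepsCTG
import Summits.AnomalousDissipation.AnomalousDissipation.Theorems.SawtoothPulseCascadeK1LocalisedCascadeGeomRatioExplicitCTG
import Summits.AnomalousDissipation.AnomalousDissipation.Theorems.SawtoothPulseCascadeK1LocalisedCascadeCTScalars
import Summits.AnomalousDissipation.AnomalousDissipation.Theorems.SawtoothPulseCascadeK1LocalisedCascadeLedgerCutoffSchedule

set_option linter.dupNamespace false

/-!
# K1loc — helper: THE FOUR LEDGER WINDOWS IN ALL-ORDERS CORNER-TRACE GRADE AT THE CRUX POINT, SUMS NORMALISED («CT-GEO»)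

Helper file of the prover lane on the crux `K1LocalisedCascade` (stmt-AnomalousDissipation-19491), route `SawtoothPulseCascade`
(S-D fibre ledger, corner-trace track; finding F-p1g9-1, memo v15).  The window theorems of `…DyadicStepsCTG` (strips (T-H), (S-V):
dyadic blocks) and `…GeomRatioExplicitCTG` (ratio classes (O-V)/(A-V), (C-H)/(B-H): blocks `⌊Λ₀(a/b)^m⌋`, box window of the block
top) at the crux point `γ = 8`, `d = 2`, `N₀ = 1`, `ρ_N = 2`, Gaussian parameter `M = 10`, round-off `ε = 2⁻⁷⁰`
(`…CTScalars.exp_neg_sq_half_ten_le`), with the four block sums handed to the numeric layer in NORMALISED form: the main sum `A` and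
the remainder maximum `β*` carry `N_j²` (the `1/π²` is moved into the conclusion `√(A/π² + β*/(2π²))`), the corner-trace kernel
factor `(√((2L+R)R)/R)²` is evaluated to `(2L+R)/R` (§1), the round-off term is majorised by `π ≤ 4` and `Λ_{m+1} ≤ Λ_{M_b}`, the
zone term by `8M/π ≤ 27` and `δ_j ≤ δs`; fibre thresholds are printed as `(Λ₀ : ℤ)` and cones as `((1 : ℕ) : ℤ)·|k₀| ≤ (v : ℤ)·|k₁|`
(the spelling of `…LedgerFeedChain` / `…TailFinal`).  No definitions; no statement about the crux.
[cite: Grafakos2014, Prop. 3.1.2 (5), Prop. 3.2.7 (3)] [problem: turb]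
-/

namespace Summit.AnomalousDissipation.AnomalousDissipation.Theorems.SawtoothPulseCascade.K1Window

open MeasureTheory Set Filter Topology UnitAddTorus Function Complex Metric
open scoped Real ENNReal
open Literature.Analysis Literature.Analysis.FunctionSpaces Literature.Analysis.FunctionSpaces.Torus Literature.Analysis.FluidPDE
open Literature.Analysis.FluidPDE.ShearStage
open Literature.Analysis.FluidPDE.SawtoothCascade Literature.Analysis.FluidPDE.SawtoothCascade.CascadeParams

/-! ## §1 Normalisation of the block sums -/

/-- `(√(ab)/b)² = a/b` (`a ≥ 0`, `b > 0`). [folklore] -/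
theorem ctg_sqrt_kernel_sq {a b : ℝ} (ha : 0 ≤ a) (hb : 0 < b) : (Real.sqrt (a * b) / b * 1) ^ 2 = a / b := by
  rw [mul_one, div_pow, Real.sq_sqrt (mul_nonneg ha hb.le)]
  field_simp

/-- The main block term: `E·(N²/π²)·τ·((√(ab)/b)²/2 + (√(ab)/b)²/2) = E·N²·τ·(a/b)/π²`. [folklore] -/
theorem ctg_main_term_eq (E N2 π2 τ a b : ℝ) (ha : 0 ≤ a) (hb : 0 < b) :
    E * (N2 / π2) * τ * ((Real.sqrt (a * b) / b * 1) ^ 2 / 2 + (Real.sqrt (a * b) / b * 1) ^ 2 / 2) =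
      E * N2 * τ * (a / b) / π2 := by
  rw [ctg_sqrt_kernel_sq ha hb]
  ring

/-- The remainder block term: `E·N²·X·Y ≤ β` gives `E·(N²/π²)·X·Y ≤ β/π²`. [folklore] -/
theorem ctg_rem_term_le {E N2 π2 X Y βs : ℝ} (hπ : 0 < π2) (h : E * N2 * X * Y ≤ βs) :
    E * (N2 / π2) * X * Y ≤ βs / π2 := by
  rw [show E * (N2 / π2) * X * Y = E * N2 * X * Y / π2 by ring]
  exact div_le_div_of_nonneg_right h hπ.le

/-- The round-off block term: `π ≤ 4` and `x ≤ X` give `(πxe/N)² ≤ 16(Xe/N)²`. [folklore] -/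
theorem ctg_round_le {x X e N ρs : ℝ} (hx : 0 ≤ x) (hxX : x ≤ X) (he : 0 ≤ e) (hN : 0 < N)
    (h : 16 * (X * e / N) ^ 2 ≤ ρs) : (π * x * e / N) ^ 2 ≤ ρs := by
  have h1 : π * x * e / N ≤ 4 * X * e / N :=
    div_le_div_of_nonneg_right (mul_le_mul_of_nonneg_right (mul_le_mul Real.pi_le_four hxX hx (by norm_num)) he) hN.le
  have h0 : 0 ≤ π * x * e / N := div_nonneg (mul_nonneg (mul_nonneg Real.pi_pos.le hx) he) hN.le
  calc (π * x * e / N) ^ 2 ≤ (4 * X * e / N) ^ 2 := pow_le_pow_left₀ h0 h1 2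
    _ = 16 * (X * e / N) ^ 2 := by ring
    _ ≤ ρs := h

/-- The zone block term: `8·10·δ/π·((√(ab)/b)²/2 + (√(ab)/b)²/2) ≤ 27·δs·(a/b)` (`0 ≤ δ ≤ δs`, `π > 3`). [folklore] -/
theorem ctg_zone_term_le {δ δs a b : ℝ} (hδ : 0 ≤ δ) (hδs : δ ≤ δs) (ha : 0 ≤ a) (hb : 0 < b) :
    8 * 10 * δ / π * ((Real.sqrt (a * b) / b * 1) ^ 2 / 2 + (Real.sqrt (a * b) / b * 1) ^ 2 / 2) ≤ 27 * δs * (a / b) := by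
  rw [ctg_sqrt_kernel_sq ha hb, add_halves]
  have hab : 0 ≤ a / b := div_nonneg ha hb.le
  have h1 : 8 * 10 * δ / π ≤ 27 * δs := by
    rw [div_le_iff₀ Real.pi_pos]
    nlinarith [Real.pi_gt_three]
  exact mul_le_mul_of_nonneg_right h1 hab

/-! ## §2 The four windows at the crux point -/

section Cascade

variable (P : CascadeParams)

set_option maxHeartbeats 800000 in
/-- **(T-H) IN CT-GEO GRADE, DYADIC BLOCKS** (`T_j(K) ≤ S_j(Λ₀) + (w_T + √O_j(Λ₀))² + far`): `…DyadicStepsCTG.lowFibre_hstep_dyadicCTG_le` at the crux point (`γ = 8`, `M = 10`, `ε = 2⁻⁷⁰`) with the block sums normalised for the numeric layer (`π`-free, `√`-free: `A`, `β*` carry `N²` instead of `N²/π²`, the round-off and zone terms majorised by `π ≤ 4`, `8M/π ≤ 27`, `δ_j ≤ δs`, `Λ_{m+1} ≤ Λ_{M_b}`). [cite: Grafakos2014, Prop. 3.1.2 (5), Prop. 3.2.7 (3)] -/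
theorem lowFibre_hstep_ctg_le (hγ : P.γ = 8) (hδ₀ : 0 < P.δ₀) (hd : P.d = 2) (hN₀ : P.N₀ = 1) (hρN : P.ρN = 2)
    (a b : ℕ → UnitAddTorus (Fin 2) → ℝ) (has : ∀ j, IsSmooth (a j)) (h0 : a 0 = datum)
    (hb : ∀ j, b j = a j ∘ shearMap 0 1 (amp ⟨P.U j, P.U_periodic j, P.contDiff_U (P.δ_pos hδ₀ (by rw [hd]; norm_num) j)⟩ P.γ))
    (hab : ∀ j, a (j + 1) = b j ∘ shearMap 1 0 (amp ⟨P.U j, P.U_periodic j, P.contDiff_U (P.δ_pos hδ₀ (by rw [hd]; norm_num) j)⟩ P.γ))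
    (j : ℕ) (K : ℕ) (Λ0 : ℕ) (hΛ0 : 1 ≤ Λ0) (Mb : ℕ)
    (ℓ r : ℕ) (hr : 0 < r) (hℓr : 2 ≤ ℓ + r) (hΛQ : K + (ℓ + r) < Λ0 * 8)
    {po : ℕ} (hp : 1 ≤ po) {εg : ℝ} (hεg : 0 < εg)
    (hMδ : 10 * P.δ j < π / 2) {δs : ℝ} (hδs : P.δ j ≤ δs)
    {u' v' : ℕ} (hfeed : u' * (Λ0 * 2) ≤ v' * ℓ)
    {A βs ρs Z : ℝ} (hβs : 0 ≤ βs) (hρs : 0 ≤ ρs)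
    (hA : ∑ m ∈ Finset.range Mb, (1 + εg) * (P.N j : ℝ) ^ 2 *
              (8 * (((Λ0 * 2 ^ m : ℕ) : ℝ) * ((8 : ℕ) : ℝ) - (((ℓ * 2 ^ m + r * 2 ^ m : ℕ) : ℝ) - 1)) ^ 2 / ((((Λ0 * 2 ^ m : ℕ) : ℝ) * ((8 : ℕ) : ℝ) - (((ℓ * 2 ^ m + r * 2 ^ m : ℕ) : ℝ) - 1)) ^ 2 - (K : ℝ) ^ 2) ^ 2 +
                8 * ((K : ℝ) + 1 / 2) / (P.N j * ((((Λ0 * 2 ^ m : ℕ) : ℝ) * ((8 : ℕ) : ℝ) - (((ℓ * 2 ^ m + r * 2 ^ m : ℕ) : ℝ) - 1)) ^ 2 - ((K : ℝ) + 1 / 2) ^ 2))) *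
              ((2 * (ℓ * 2 ^ m) + r * 2 ^ m : ℕ) / ((r * 2 ^ m : ℕ) : ℝ)) ≤ A)
    (hβ : ∀ m ∈ Finset.range Mb, (1 + εg⁻¹) * (P.N j : ℝ) ^ 2 * (4 / (((Λ0 * 2 ^ m * 8 - K - (ℓ * 2 ^ m + r * 2 ^ m) : ℕ) : ℝ)) ^ 2 *
              (1 / ((((Λ0 * 2 ^ m * 8 - K - (ℓ * 2 ^ m + r * 2 ^ m) : ℕ) : ℝ)) + ((ℓ * 2 ^ m + r * 2 ^ m : ℕ) : ℝ)) ^ (2 * po) +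
                1 / (P.N j * ((((Λ0 * 2 ^ m * 8 - K - (ℓ * 2 ^ m + r * 2 ^ m) : ℕ) : ℝ)) + ((ℓ * 2 ^ m + r * 2 ^ m : ℕ) : ℝ)) ^ (2 * po - 1)))) *
              ((2 * ((ℓ * 2 ^ m + r * 2 ^ m : ℕ) : ℝ) / P.N j + 1) * ((ℓ * 2 ^ m + r * 2 ^ m : ℕ) : ℝ) ^ (2 * po)) ≤ βs)
    (hρ : 16 * (((Λ0 * 2 ^ Mb * 8 : ℕ) : ℝ) * ((2 : ℝ)⁻¹ ^ 70) / P.N j) ^ 2 ≤ ρs)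
    (hZ : ∑ m ∈ Finset.range Mb, 27 * δs * ((2 * (ℓ * 2 ^ m) + r * 2 ^ m : ℕ) / ((r * 2 ^ m : ℕ) : ℝ)) ≤ Z) :
    ∑' k : Fin 2 → ℤ, (if |k 1| < (K : ℤ) then (1 : ℝ) else 0) * ‖mFourierCoeff (fun x => (b j x : ℂ)) k‖ ^ 2 ≤
      ∑' k : Fin 2 → ℤ, (if |k 0| < (Λ0 : ℤ) then (1 : ℝ) else 0) * ‖mFourierCoeff (fun x => (a j x : ℂ)) k‖ ^ 2 +
      ((Real.sqrt (A / π ^ 2 + βs / π ^ 2 / 2) + Real.sqrt (ρs / 2 + Z) +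
          Real.sqrt (∑' k : Fin 2 → ℤ, (if (Λ0 : ℤ) ≤ |k 0| ∧ (u' : ℤ) * |k 0| ≤ (v' : ℤ) * |k 1| then (1 : ℝ) else 0) *
            ‖mFourierCoeff (fun x => (a j x : ℂ)) k‖ ^ 2)) ^ 2 +
        ((1 + P.γ) ^ (2 * j) / ((Λ0 * 2 ^ Mb : ℕ) : ℝ)) ^ 2)  := by
  have hγ' : P.γ = ((8 : ℕ) : ℝ) := by rw [hγ]; norm_num
  have hd' : 0 < P.d := by rw [hd]; norm_num
  have hN₀' : 1 ≤ P.N₀ := by rw [hN₀]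
  have hρN' : 1 ≤ P.ρN := by rw [hρN]; norm_num
  have hε : Real.exp (-((10 : ℝ) ^ 2 / 2)) ≤ (2 : ℝ)⁻¹ ^ 70 := exp_neg_sq_half_ten_le
  have hM : (1 : ℝ) ≤ 10 := by norm_num
  have hN : (0 : ℝ) < P.N j := by rw [K1Ledger.N_cast_eq P hN₀ hρN]; positivity
  have hπ : (0 : ℝ) < π ^ 2 := by positivity
  have hδ0 : 0 ≤ P.δ j := (P.δ_pos hδ₀ hd' j).le
  have hbpos : ∀ m : ℕ, (0 : ℝ) < ((r * 2 ^ m : ℕ) : ℝ) := fun m => Nat.cast_pos.mpr (Nat.mul_pos hr (Nat.two_pow_pos m))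
  have hA₀ : ∑ m ∈ Finset.range Mb, (1 + εg) * ((P.N j : ℝ) ^ 2 / π ^ 2) *
              (8 * (((Λ0 * 2 ^ m : ℕ) : ℝ) * ((8 : ℕ) : ℝ) - (((ℓ * 2 ^ m + r * 2 ^ m : ℕ) : ℝ) - 1)) ^ 2 / ((((Λ0 * 2 ^ m : ℕ) : ℝ) * ((8 : ℕ) : ℝ) - (((ℓ * 2 ^ m + r * 2 ^ m : ℕ) : ℝ) - 1)) ^ 2 - (K : ℝ) ^ 2) ^ 2 +
                8 * ((K : ℝ) + 1 / 2) / (P.N j * ((((Λ0 * 2 ^ m : ℕ) : ℝ) * ((8 : ℕ) : ℝ) - (((ℓ * 2 ^ m + r * 2 ^ m : ℕ) : ℝ) - 1)) ^ 2 - ((K : ℝ) + 1 / 2) ^ 2))) *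
              ((Real.sqrt ((2 * (ℓ * 2 ^ m) + r * 2 ^ m : ℕ) * ((r * 2 ^ m : ℕ) : ℝ)) / ((r * 2 ^ m : ℕ) : ℝ) * 1) ^ 2 / 2 + (Real.sqrt ((2 * (ℓ * 2 ^ m) + r * 2 ^ m : ℕ) * ((r * 2 ^ m : ℕ) : ℝ)) / ((r * 2 ^ m : ℕ) : ℝ) * 1) ^ 2 / 2) ≤ A / π ^ 2 := by
    have e : ∑ m ∈ Finset.range Mb, (1 + εg) * ((P.N j : ℝ) ^ 2 / π ^ 2) *
              (8 * (((Λ0 * 2 ^ m : ℕ) : ℝ) * ((8 : ℕ) : ℝ) - (((ℓ * 2 ^ m + r * 2 ^ m : ℕ) : ℝ) - 1)) ^ 2 / ((((Λ0 * 2 ^ m : ℕ) : ℝ) * ((8 : ℕ) : ℝ) - (((ℓ * 2 ^ m + r * 2 ^ m : ℕ) : ℝ) - 1)) ^ 2 - (K : ℝ) ^ 2) ^ 2 +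
                8 * ((K : ℝ) + 1 / 2) / (P.N j * ((((Λ0 * 2 ^ m : ℕ) : ℝ) * ((8 : ℕ) : ℝ) - (((ℓ * 2 ^ m + r * 2 ^ m : ℕ) : ℝ) - 1)) ^ 2 - ((K : ℝ) + 1 / 2) ^ 2))) *
              ((Real.sqrt ((2 * (ℓ * 2 ^ m) + r * 2 ^ m : ℕ) * ((r * 2 ^ m : ℕ) : ℝ)) / ((r * 2 ^ m : ℕ) : ℝ) * 1) ^ 2 / 2 + (Real.sqrt ((2 * (ℓ * 2 ^ m) + r * 2 ^ m : ℕ) * ((r * 2 ^ m : ℕ) : ℝ)) / ((r * 2 ^ m : ℕ) : ℝ) * 1) ^ 2 / 2) =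
        (∑ m ∈ Finset.range Mb, (1 + εg) * (P.N j : ℝ) ^ 2 *
              (8 * (((Λ0 * 2 ^ m : ℕ) : ℝ) * ((8 : ℕ) : ℝ) - (((ℓ * 2 ^ m + r * 2 ^ m : ℕ) : ℝ) - 1)) ^ 2 / ((((Λ0 * 2 ^ m : ℕ) : ℝ) * ((8 : ℕ) : ℝ) - (((ℓ * 2 ^ m + r * 2 ^ m : ℕ) : ℝ) - 1)) ^ 2 - (K : ℝ) ^ 2) ^ 2 +
                8 * ((K : ℝ) + 1 / 2) / (P.N j * ((((Λ0 * 2 ^ m : ℕ) : ℝ) * ((8 : ℕ) : ℝ) - (((ℓ * 2 ^ m + r * 2 ^ m : ℕ) : ℝ) - 1)) ^ 2 - ((K : ℝ) + 1 / 2) ^ 2))) *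
              ((2 * (ℓ * 2 ^ m) + r * 2 ^ m : ℕ) / ((r * 2 ^ m : ℕ) : ℝ))) / π ^ 2 := by
      rw [Finset.sum_div]
      refine Finset.sum_congr rfl fun m _ => ?_
      exact ctg_main_term_eq _ _ _ _ _ _ (Nat.cast_nonneg _) (hbpos m)
    rw [e]
    exact div_le_div_of_nonneg_right hA hπ.le
  have hβ₀ : ∀ m ∈ Finset.range Mb, (1 + εg⁻¹) * ((P.N j : ℝ) ^ 2 / π ^ 2) * (4 / (((Λ0 * 2 ^ m * 8 - K - (ℓ * 2 ^ m + r * 2 ^ m) : ℕ) : ℝ)) ^ 2 *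
              (1 / ((((Λ0 * 2 ^ m * 8 - K - (ℓ * 2 ^ m + r * 2 ^ m) : ℕ) : ℝ)) + ((ℓ * 2 ^ m + r * 2 ^ m : ℕ) : ℝ)) ^ (2 * po) +
                1 / (P.N j * ((((Λ0 * 2 ^ m * 8 - K - (ℓ * 2 ^ m + r * 2 ^ m) : ℕ) : ℝ)) + ((ℓ * 2 ^ m + r * 2 ^ m : ℕ) : ℝ)) ^ (2 * po - 1)))) *
              ((2 * ((ℓ * 2 ^ m + r * 2 ^ m : ℕ) : ℝ) / P.N j + 1) * ((ℓ * 2 ^ m + r * 2 ^ m : ℕ) : ℝ) ^ (2 * po)) ≤ βs / π ^ 2 := fun m hm => ctg_rem_term_le hπ (hβ m hm)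
  have hρ₀ : ∀ m ∈ Finset.range Mb, (π * ((Λ0 * 2 ^ (m + 1) * 8 : ℕ) : ℝ) * (2 : ℝ)⁻¹ ^ 70 / P.N j) ^ 2 ≤ ρs := fun m hm => by
    have hle := (Nat.mul_le_mul_right 8 (Nat.mul_le_mul_left Λ0 (Nat.pow_le_pow_right (by norm_num) (Finset.mem_range.mp hm))) : Λ0 * 2 ^ (m + 1) * 8 ≤ Λ0 * 2 ^ Mb * 8)
    exact ctg_round_le (Nat.cast_nonneg _) (by exact_mod_cast hle) (by positivity) hN hρ
  have hZ₀ : ∑ m ∈ Finset.range Mb, 8 * 10 * P.δ j / π * ((Real.sqrt ((2 * (ℓ * 2 ^ m) + r * 2 ^ m : ℕ) * ((r * 2 ^ m : ℕ) : ℝ)) / ((r * 2 ^ m : ℕ) : ℝ) * 1) ^ 2 / 2 +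
        (Real.sqrt ((2 * (ℓ * 2 ^ m) + r * 2 ^ m : ℕ) * ((r * 2 ^ m : ℕ) : ℝ)) / ((r * 2 ^ m : ℕ) : ℝ) * 1) ^ 2 / 2) ≤ Z :=
    (Finset.sum_le_sum fun m _ => ctg_zone_term_le hδ0 hδs (Nat.cast_nonneg _) (hbpos m)).trans hZ
  have h := lowFibre_hstep_dyadicCTG_le P hγ' hδ₀ hd' hN₀' hρN' a b has h0 hb hab j K Λ0 hΛ0 Mb ℓ r hr hℓr hΛQ hp hεg hM hMδ hε hfeed (div_nonneg hβs hπ.le) hρs hA₀ hβ₀ hρ₀ hZ₀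
  simpa only [Nat.pow_zero, Nat.mul_one] using h


set_option maxHeartbeats 800000 in
/-- **(S-V) IN CT-GEO GRADE, DYADIC BLOCKS** (`S_{j+1}(K) ≤ T_j(Λ₀) + (w_S + √C_j(Y))² + far`): `…DyadicStepsCTG.strip_vstep_dyadicCTG_le` at the crux point, block sums normalised as in `lowFibre_hstep_ctg_le`. [cite: Grafakos2014, Prop. 3.1.2 (5), Prop. 3.2.7 (3)] -/
theorem strip_vstep_ctg_le (hγ : P.γ = 8) (hδ₀ : 0 < P.δ₀) (hd : P.d = 2) (hN₀ : P.N₀ = 1) (hρN : P.ρN = 2)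
    (a b : ℕ → UnitAddTorus (Fin 2) → ℝ) (has : ∀ j, IsSmooth (a j)) (h0 : a 0 = datum)
    (hb : ∀ j, b j = a j ∘ shearMap 0 1 (amp ⟨P.U j, P.U_periodic j, P.contDiff_U (P.δ_pos hδ₀ (by rw [hd]; norm_num) j)⟩ P.γ))
    (hab : ∀ j, a (j + 1) = b j ∘ shearMap 1 0 (amp ⟨P.U j, P.U_periodic j, P.contDiff_U (P.δ_pos hδ₀ (by rw [hd]; norm_num) j)⟩ P.γ))
    (j : ℕ) (K : ℕ) (Λ0 : ℕ) (hΛ0 : 1 ≤ Λ0) (Mb : ℕ)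
    (ℓ r : ℕ) (hr : 0 < r) (hℓr : 2 ≤ ℓ + r) (hΛQ : K + (ℓ + r) < Λ0 * 8)
    {po : ℕ} (hp : 1 ≤ po) {εg : ℝ} (hεg : 0 < εg)
    (hMδ : 10 * P.δ j < π / 2) {δs : ℝ} (hδs : P.δ j ≤ δs)
    {u' v' Y : ℕ} (hfeed : u' * (Λ0 * 2) ≤ v' * ℓ) (hY : Y ≤ ℓ + 1)
    {A βs ρs Z : ℝ} (hβs : 0 ≤ βs) (hρs : 0 ≤ ρs)
    (hA : ∑ m ∈ Finset.range Mb, (1 + εg) * (P.N j : ℝ) ^ 2 *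
              (8 * (((Λ0 * 2 ^ m : ℕ) : ℝ) * ((8 : ℕ) : ℝ) - (((ℓ * 2 ^ m + r * 2 ^ m : ℕ) : ℝ) - 1)) ^ 2 / ((((Λ0 * 2 ^ m : ℕ) : ℝ) * ((8 : ℕ) : ℝ) - (((ℓ * 2 ^ m + r * 2 ^ m : ℕ) : ℝ) - 1)) ^ 2 - (K : ℝ) ^ 2) ^ 2 +
                8 * ((K : ℝ) + 1 / 2) / (P.N j * ((((Λ0 * 2 ^ m : ℕ) : ℝ) * ((8 : ℕ) : ℝ) - (((ℓ * 2 ^ m + r * 2 ^ m : ℕ) : ℝ) - 1)) ^ 2 - ((K : ℝ) + 1 / 2) ^ 2))) *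
              ((2 * (ℓ * 2 ^ m) + r * 2 ^ m : ℕ) / ((r * 2 ^ m : ℕ) : ℝ)) ≤ A)
    (hβ : ∀ m ∈ Finset.range Mb, (1 + εg⁻¹) * (P.N j : ℝ) ^ 2 * (4 / (((Λ0 * 2 ^ m * 8 - K - (ℓ * 2 ^ m + r * 2 ^ m) : ℕ) : ℝ)) ^ 2 *
              (1 / ((((Λ0 * 2 ^ m * 8 - K - (ℓ * 2 ^ m + r * 2 ^ m) : ℕ) : ℝ)) + ((ℓ * 2 ^ m + r * 2 ^ m : ℕ) : ℝ)) ^ (2 * po) +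
                1 / (P.N j * ((((Λ0 * 2 ^ m * 8 - K - (ℓ * 2 ^ m + r * 2 ^ m) : ℕ) : ℝ)) + ((ℓ * 2 ^ m + r * 2 ^ m : ℕ) : ℝ)) ^ (2 * po - 1)))) *
              ((2 * ((ℓ * 2 ^ m + r * 2 ^ m : ℕ) : ℝ) / P.N j + 1) * ((ℓ * 2 ^ m + r * 2 ^ m : ℕ) : ℝ) ^ (2 * po)) ≤ βs)
    (hρ : 16 * (((Λ0 * 2 ^ Mb * 8 : ℕ) : ℝ) * ((2 : ℝ)⁻¹ ^ 70) / P.N j) ^ 2 ≤ ρs)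
    (hZ : ∑ m ∈ Finset.range Mb, 27 * δs * ((2 * (ℓ * 2 ^ m) + r * 2 ^ m : ℕ) / ((r * 2 ^ m : ℕ) : ℝ)) ≤ Z) :
    ∑' k : Fin 2 → ℤ, (if |k 0| < (K : ℤ) then (1 : ℝ) else 0) * ‖mFourierCoeff (fun x => (a (j + 1) x : ℂ)) k‖ ^ 2 ≤
      ∑' k : Fin 2 → ℤ, (if |k 1| < (Λ0 : ℤ) then (1 : ℝ) else 0) * ‖mFourierCoeff (fun x => (b j x : ℂ)) k‖ ^ 2 +
      ((Real.sqrt (A / π ^ 2 + βs / π ^ 2 / 2) + Real.sqrt (ρs / 2 + Z) +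
          Real.sqrt (∑' k : Fin 2 → ℤ, (if (Y : ℤ) ≤ |k 0| ∧ (u' : ℤ) * |k 1| ≤ (v' : ℤ) * |k 0| then (1 : ℝ) else 0) *
            ‖mFourierCoeff (fun x => (b j x : ℂ)) k‖ ^ 2)) ^ 2 +
        ((1 + P.γ) ^ (2 * (j + 1)) / ((Λ0 * 2 ^ Mb : ℕ) : ℝ)) ^ 2)  := by
  have hγ' : P.γ = ((8 : ℕ) : ℝ) := by rw [hγ]; norm_num
  have hd' : 0 < P.d := by rw [hd]; norm_num
  have hN₀' : 1 ≤ P.N₀ := by rw [hN₀]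
  have hρN' : 1 ≤ P.ρN := by rw [hρN]; norm_num
  have hε : Real.exp (-((10 : ℝ) ^ 2 / 2)) ≤ (2 : ℝ)⁻¹ ^ 70 := exp_neg_sq_half_ten_le
  have hM : (1 : ℝ) ≤ 10 := by norm_num
  have hN : (0 : ℝ) < P.N j := by rw [K1Ledger.N_cast_eq P hN₀ hρN]; positivity
  have hπ : (0 : ℝ) < π ^ 2 := by positivity
  have hδ0 : 0 ≤ P.δ j := (P.δ_pos hδ₀ hd' j).le
  have hbpos : ∀ m : ℕ, (0 : ℝ) < ((r * 2 ^ m : ℕ) : ℝ) := fun m => Nat.cast_pos.mpr (Nat.mul_pos hr (Nat.two_pow_pos m))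
  have hA₀ : ∑ m ∈ Finset.range Mb, (1 + εg) * ((P.N j : ℝ) ^ 2 / π ^ 2) *
              (8 * (((Λ0 * 2 ^ m : ℕ) : ℝ) * ((8 : ℕ) : ℝ) - (((ℓ * 2 ^ m + r * 2 ^ m : ℕ) : ℝ) - 1)) ^ 2 / ((((Λ0 * 2 ^ m : ℕ) : ℝ) * ((8 : ℕ) : ℝ) - (((ℓ * 2 ^ m + r * 2 ^ m : ℕ) : ℝ) - 1)) ^ 2 - (K : ℝ) ^ 2) ^ 2 +
                8 * ((K : ℝ) + 1 / 2) / (P.N j * ((((Λ0 * 2 ^ m : ℕ) : ℝ) * ((8 : ℕ) : ℝ) - (((ℓ * 2 ^ m + r * 2 ^ m : ℕ) : ℝ) - 1)) ^ 2 - ((K : ℝ) + 1 / 2) ^ 2))) *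
              ((Real.sqrt ((2 * (ℓ * 2 ^ m) + r * 2 ^ m : ℕ) * ((r * 2 ^ m : ℕ) : ℝ)) / ((r * 2 ^ m : ℕ) : ℝ) * 1) ^ 2 / 2 + (Real.sqrt ((2 * (ℓ * 2 ^ m) + r * 2 ^ m : ℕ) * ((r * 2 ^ m : ℕ) : ℝ)) / ((r * 2 ^ m : ℕ) : ℝ) * 1) ^ 2 / 2) ≤ A / π ^ 2 := by
    have e : ∑ m ∈ Finset.range Mb, (1 + εg) * ((P.N j : ℝ) ^ 2 / π ^ 2) *
              (8 * (((Λ0 * 2 ^ m : ℕ) : ℝ) * ((8 : ℕ) : ℝ) - (((ℓ * 2 ^ m + r * 2 ^ m : ℕ) : ℝ) - 1)) ^ 2 / ((((Λ0 * 2 ^ m : ℕ) : ℝ) * ((8 : ℕ) : ℝ) - (((ℓ * 2 ^ m + r * 2 ^ m : ℕ) : ℝ) - 1)) ^ 2 - (K : ℝ) ^ 2) ^ 2 +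
                8 * ((K : ℝ) + 1 / 2) / (P.N j * ((((Λ0 * 2 ^ m : ℕ) : ℝ) * ((8 : ℕ) : ℝ) - (((ℓ * 2 ^ m + r * 2 ^ m : ℕ) : ℝ) - 1)) ^ 2 - ((K : ℝ) + 1 / 2) ^ 2))) *
              ((Real.sqrt ((2 * (ℓ * 2 ^ m) + r * 2 ^ m : ℕ) * ((r * 2 ^ m : ℕ) : ℝ)) / ((r * 2 ^ m : ℕ) : ℝ) * 1) ^ 2 / 2 + (Real.sqrt ((2 * (ℓ * 2 ^ m) + r * 2 ^ m : ℕ) * ((r * 2 ^ m : ℕ) : ℝ)) / ((r * 2 ^ m : ℕ) : ℝ) * 1) ^ 2 / 2) =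
        (∑ m ∈ Finset.range Mb, (1 + εg) * (P.N j : ℝ) ^ 2 *
              (8 * (((Λ0 * 2 ^ m : ℕ) : ℝ) * ((8 : ℕ) : ℝ) - (((ℓ * 2 ^ m + r * 2 ^ m : ℕ) : ℝ) - 1)) ^ 2 / ((((Λ0 * 2 ^ m : ℕ) : ℝ) * ((8 : ℕ) : ℝ) - (((ℓ * 2 ^ m + r * 2 ^ m : ℕ) : ℝ) - 1)) ^ 2 - (K : ℝ) ^ 2) ^ 2 +
                8 * ((K : ℝ) + 1 / 2) / (P.N j * ((((Λ0 * 2 ^ m : ℕ) : ℝ) * ((8 : ℕ) : ℝ) - (((ℓ * 2 ^ m + r * 2 ^ m : ℕ) : ℝ) - 1)) ^ 2 - ((K : ℝ) + 1 / 2) ^ 2))) *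
              ((2 * (ℓ * 2 ^ m) + r * 2 ^ m : ℕ) / ((r * 2 ^ m : ℕ) : ℝ))) / π ^ 2 := by
      rw [Finset.sum_div]
      refine Finset.sum_congr rfl fun m _ => ?_
      exact ctg_main_term_eq _ _ _ _ _ _ (Nat.cast_nonneg _) (hbpos m)
    rw [e]
    exact div_le_div_of_nonneg_right hA hπ.le
  have hβ₀ : ∀ m ∈ Finset.range Mb, (1 + εg⁻¹) * ((P.N j : ℝ) ^ 2 / π ^ 2) * (4 / (((Λ0 * 2 ^ m * 8 - K - (ℓ * 2 ^ m + r * 2 ^ m) : ℕ) : ℝ)) ^ 2 *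
              (1 / ((((Λ0 * 2 ^ m * 8 - K - (ℓ * 2 ^ m + r * 2 ^ m) : ℕ) : ℝ)) + ((ℓ * 2 ^ m + r * 2 ^ m : ℕ) : ℝ)) ^ (2 * po) +
                1 / (P.N j * ((((Λ0 * 2 ^ m * 8 - K - (ℓ * 2 ^ m + r * 2 ^ m) : ℕ) : ℝ)) + ((ℓ * 2 ^ m + r * 2 ^ m : ℕ) : ℝ)) ^ (2 * po - 1)))) *
              ((2 * ((ℓ * 2 ^ m + r * 2 ^ m : ℕ) : ℝ) / P.N j + 1) * ((ℓ * 2 ^ m + r * 2 ^ m : ℕ) : ℝ) ^ (2 * po)) ≤ βs / π ^ 2 := fun m hm => ctg_rem_term_le hπ (hβ m hm)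
  have hρ₀ : ∀ m ∈ Finset.range Mb, (π * ((Λ0 * 2 ^ (m + 1) * 8 : ℕ) : ℝ) * (2 : ℝ)⁻¹ ^ 70 / P.N j) ^ 2 ≤ ρs := fun m hm => by
    have hle := (Nat.mul_le_mul_right 8 (Nat.mul_le_mul_left Λ0 (Nat.pow_le_pow_right (by norm_num) (Finset.mem_range.mp hm))) : Λ0 * 2 ^ (m + 1) * 8 ≤ Λ0 * 2 ^ Mb * 8)
    exact ctg_round_le (Nat.cast_nonneg _) (by exact_mod_cast hle) (by positivity) hN hρ
  have hZ₀ : ∑ m ∈ Finset.range Mb, 8 * 10 * P.δ j / π * ((Real.sqrt ((2 * (ℓ * 2 ^ m) + r * 2 ^ m : ℕ) * ((r * 2 ^ m : ℕ) : ℝ)) / ((r * 2 ^ m : ℕ) : ℝ) * 1) ^ 2 / 2 +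
        (Real.sqrt ((2 * (ℓ * 2 ^ m) + r * 2 ^ m : ℕ) * ((r * 2 ^ m : ℕ) : ℝ)) / ((r * 2 ^ m : ℕ) : ℝ) * 1) ^ 2 / 2) ≤ Z :=
    (Finset.sum_le_sum fun m _ => ctg_zone_term_le hδ0 hδs (Nat.cast_nonneg _) (hbpos m)).trans hZ
  have h := strip_vstep_dyadicCTG_le P hγ' hδ₀ hd' hN₀' hρN' a b has h0 hb hab j K Λ0 hΛ0 Mb ℓ r hr hℓr hΛQ hp hεg hM hMδ hε hfeed hY (div_nonneg hβs hπ.le) hρs hA₀ hβ₀ hρ₀ hZ₀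
  simpa only [Nat.pow_zero, Nat.mul_one] using h


set_option maxHeartbeats 800000 in
/-- **RATIO CLASS, V-STEP, IN CT-GEO GRADE, GEOMETRIC BLOCKS** ((O-V) with `v = 4`, (A-V) with `v = 2`: `Σ_{|k₀| ≥ X, |k₀| ≤ v|k₁|} |â_{j+1}|² ≤ (w + √C_j(Y))² + far`): `…GeomRatioExplicitCTG.ratioClass_vstep_geomExplicitCTG_le` at the crux point, block sums normalised as in `lowFibre_hstep_ctg_le`. [cite: Grafakos2014, Prop. 3.1.2 (5), Prop. 3.2.7 (3)] -/
theorem ratio_vstep_ctg_le (hγ : P.γ = 8) (hδ₀ : 0 < P.δ₀) (hd : P.d = 2) (hN₀ : P.N₀ = 1) (hρN : P.ρN = 2)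
    (a b : ℕ → UnitAddTorus (Fin 2) → ℝ) (has : ∀ j, IsSmooth (a j)) (h0 : a 0 = datum)
    (hb : ∀ j, b j = a j ∘ shearMap 0 1 (amp ⟨P.U j, P.U_periodic j, P.contDiff_U (P.δ_pos hδ₀ (by rw [hd]; norm_num) j)⟩ P.γ))
    (hab : ∀ j, a (j + 1) = b j ∘ shearMap 1 0 (amp ⟨P.U j, P.U_periodic j, P.contDiff_U (P.δ_pos hδ₀ (by rw [hd]; norm_num) j)⟩ P.γ))
    (j : ℕ) {v X : ℕ} (hv : 0 < v)
    {ra rb qn qd : ℕ} (Λ0 : ℕ) (hrb : 0 < rb) (hrab : rb < ra) (hΛ0 : 2 ≤ Λ0) (Mb : ℕ) (hqd : 0 < qd) (hΛX : v * Λ0 ≤ X)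
    {u' v' : ℕ} (hv' : 0 < v') (hslope : ra * qd * u' ≤ rb * v' * qn)
    (hbase : qd * (u' * (ra - 1) + rb * v') + ra * qd * u' * Λ0 ≤ rb * v' * qn * Λ0) (hQ2 : 2 * qd ≤ qn * Λ0)
    (hgap : v * (ra - 1) * qd + rb * qd + (v * ra * qd + qn * rb) * Λ0 ≤ 8 * rb * qd * Λ0) (hgapc : v * ra * qd + qn * rb ≤ 8 * rb * qd)
    {po : ℕ} (hp : 1 ≤ po) {εg : ℝ} (hεg : 0 < εg)
    (hMδ : 10 * P.δ j < π / 2) {δs : ℝ} (hδs : P.δ j ≤ δs)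
    {Y : ℕ} (hY : Y ≤ u' * Λ0 / v' + 1)
    {A βs ρs Z : ℝ} (hβs : 0 ≤ βs) (hρs : 0 ≤ ρs)
    (hA : ∑ m ∈ Finset.range Mb, (1 + εg) * (P.N j : ℝ) ^ 2 *
              (8 * ((((Λ0 * ra ^ m / rb ^ m) : ℕ) : ℝ) * ((8 : ℕ) : ℝ) - ((((u' * (Λ0 * ra ^ (m + 1) / rb ^ (m + 1)) / v') + ((qn * (Λ0 * ra ^ m / rb ^ m) / qd) - (u' * (Λ0 * ra ^ (m + 1) / rb ^ (m + 1)) / v')) : ℕ) : ℝ) - 1)) ^ 2 / (((((Λ0 * ra ^ m / rb ^ m) : ℕ) : ℝ) * ((8 : ℕ) : ℝ) - ((((u' * (Λ0 * ra ^ (m + 1) / rb ^ (m + 1)) / v') + ((qn * (Λ0 * ra ^ m / rb ^ m) / qd) - (u' * (Λ0 * ra ^ (m + 1) / rb ^ (m + 1)) / v')) : ℕ) : ℝ) - 1)) ^ 2 - ((v * (Λ0 * ra ^ (m + 1) / rb ^ (m + 1)) / 1 : ℕ) : ℝ) ^ 2) ^ 2 +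
                8 * (((v * (Λ0 * ra ^ (m + 1) / rb ^ (m + 1)) / 1 : ℕ) : ℝ) + 1 / 2) / (P.N j * (((((Λ0 * ra ^ m / rb ^ m) : ℕ) : ℝ) * ((8 : ℕ) : ℝ) - ((((u' * (Λ0 * ra ^ (m + 1) / rb ^ (m + 1)) / v') + ((qn * (Λ0 * ra ^ m / rb ^ m) / qd) - (u' * (Λ0 * ra ^ (m + 1) / rb ^ (m + 1)) / v')) : ℕ) : ℝ) - 1)) ^ 2 - (((v * (Λ0 * ra ^ (m + 1) / rb ^ (m + 1)) / 1 : ℕ) : ℝ) + 1 / 2) ^ 2))) *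
              ((2 * (u' * (Λ0 * ra ^ (m + 1) / rb ^ (m + 1)) / v') + ((qn * (Λ0 * ra ^ m / rb ^ m) / qd) - (u' * (Λ0 * ra ^ (m + 1) / rb ^ (m + 1)) / v')) : ℕ) / ((((qn * (Λ0 * ra ^ m / rb ^ m) / qd) - (u' * (Λ0 * ra ^ (m + 1) / rb ^ (m + 1)) / v')) : ℕ) : ℝ)) ≤ A)
    (hβ : ∀ m ∈ Finset.range Mb, (1 + εg⁻¹) * (P.N j : ℝ) ^ 2 * (4 / ((((Λ0 * ra ^ m / rb ^ m) * 8 - v * (Λ0 * ra ^ (m + 1) / rb ^ (m + 1)) / 1 - ((u' * (Λ0 * ra ^ (m + 1) / rb ^ (m + 1)) / v') + ((qn * (Λ0 * ra ^ m / rb ^ m) / qd) - (u' * (Λ0 * ra ^ (m + 1) / rb ^ (m + 1)) / v'))) : ℕ) : ℝ)) ^ 2 *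
              (1 / (((((Λ0 * ra ^ m / rb ^ m) * 8 - v * (Λ0 * ra ^ (m + 1) / rb ^ (m + 1)) / 1 - ((u' * (Λ0 * ra ^ (m + 1) / rb ^ (m + 1)) / v') + ((qn * (Λ0 * ra ^ m / rb ^ m) / qd) - (u' * (Λ0 * ra ^ (m + 1) / rb ^ (m + 1)) / v'))) : ℕ) : ℝ)) + (((u' * (Λ0 * ra ^ (m + 1) / rb ^ (m + 1)) / v') + ((qn * (Λ0 * ra ^ m / rb ^ m) / qd) - (u' * (Λ0 * ra ^ (m + 1) / rb ^ (m + 1)) / v')) : ℕ) : ℝ)) ^ (2 * po) +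
                1 / (P.N j * (((((Λ0 * ra ^ m / rb ^ m) * 8 - v * (Λ0 * ra ^ (m + 1) / rb ^ (m + 1)) / 1 - ((u' * (Λ0 * ra ^ (m + 1) / rb ^ (m + 1)) / v') + ((qn * (Λ0 * ra ^ m / rb ^ m) / qd) - (u' * (Λ0 * ra ^ (m + 1) / rb ^ (m + 1)) / v'))) : ℕ) : ℝ)) + (((u' * (Λ0 * ra ^ (m + 1) / rb ^ (m + 1)) / v') + ((qn * (Λ0 * ra ^ m / rb ^ m) / qd) - (u' * (Λ0 * ra ^ (m + 1) / rb ^ (m + 1)) / v')) : ℕ) : ℝ)) ^ (2 * po - 1)))) *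
              ((2 * (((u' * (Λ0 * ra ^ (m + 1) / rb ^ (m + 1)) / v') + ((qn * (Λ0 * ra ^ m / rb ^ m) / qd) - (u' * (Λ0 * ra ^ (m + 1) / rb ^ (m + 1)) / v')) : ℕ) : ℝ) / P.N j + 1) * (((u' * (Λ0 * ra ^ (m + 1) / rb ^ (m + 1)) / v') + ((qn * (Λ0 * ra ^ m / rb ^ m) / qd) - (u' * (Λ0 * ra ^ (m + 1) / rb ^ (m + 1)) / v')) : ℕ) : ℝ) ^ (2 * po)) ≤ βs)
    (hρ : 16 * ((((Λ0 * ra ^ Mb / rb ^ Mb) * 8 : ℕ) : ℝ) * ((2 : ℝ)⁻¹ ^ 70) / P.N j) ^ 2 ≤ ρs)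
    (hZ : ∑ m ∈ Finset.range Mb, 27 * δs * ((2 * (u' * (Λ0 * ra ^ (m + 1) / rb ^ (m + 1)) / v') + ((qn * (Λ0 * ra ^ m / rb ^ m) / qd) - (u' * (Λ0 * ra ^ (m + 1) / rb ^ (m + 1)) / v')) : ℕ) / ((((qn * (Λ0 * ra ^ m / rb ^ m) / qd) - (u' * (Λ0 * ra ^ (m + 1) / rb ^ (m + 1)) / v')) : ℕ) : ℝ)) ≤ Z) :
    ∑' k : Fin 2 → ℤ, (if (X : ℤ) ≤ |k 0| ∧ (((1 : ℕ)) : ℤ) * |k 0| ≤ (v : ℤ) * |k 1| then (1 : ℝ) else 0) *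
        ‖mFourierCoeff (fun x => (a (j + 1) x : ℂ)) k‖ ^ 2 ≤
      (Real.sqrt (A / π ^ 2 + βs / π ^ 2 / 2) + Real.sqrt (ρs / 2 + Z) +
          Real.sqrt (∑' k : Fin 2 → ℤ, (if (Y : ℤ) ≤ |k 0| ∧ (u' : ℤ) * |k 1| ≤ (v' : ℤ) * |k 0| then (1 : ℝ) else 0) *
            ‖mFourierCoeff (fun x => (b j x : ℂ)) k‖ ^ 2)) ^ 2 +
        ((1 + P.γ) ^ (2 * (j + 1)) / ((Λ0 * ra ^ Mb / rb ^ Mb : ℕ) : ℝ)) ^ 2  := by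
  have hγ' : P.γ = ((8 : ℕ) : ℝ) := by rw [hγ]; norm_num
  have hd' : 0 < P.d := by rw [hd]; norm_num
  have hN₀' : 1 ≤ P.N₀ := by rw [hN₀]
  have hρN' : 1 ≤ P.ρN := by rw [hρN]; norm_num
  have hε : Real.exp (-((10 : ℝ) ^ 2 / 2)) ≤ (2 : ℝ)⁻¹ ^ 70 := exp_neg_sq_half_ten_le
  have hM : (1 : ℝ) ≤ 10 := by norm_num
  have hN : (0 : ℝ) < P.N j := by rw [K1Ledger.N_cast_eq P hN₀ hρN]; positivity
  have hπ : (0 : ℝ) < π ^ 2 := by positivity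
  have hδ0 : 0 ≤ P.δ j := (P.δ_pos hδ₀ hd' j).le
  have hbpos : ∀ m : ℕ, (0 : ℝ) < ((((qn * (Λ0 * ra ^ m / rb ^ m) / qd) - (u' * (Λ0 * ra ^ (m + 1) / rb ^ (m + 1)) / v')) : ℕ) : ℝ) := fun m => Nat.cast_pos.mpr (Nat.sub_pos_of_lt (geom_sep hrb hv' hqd (geom_blocks_succ_le hrb (by omega) Λ0 m) (geom_blocks_ge hrb hrab.le Λ0 m) hslope hbase))
  have hA₀ : ∑ m ∈ Finset.range Mb, (1 + εg) * ((P.N j : ℝ) ^ 2 / π ^ 2) *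
              (8 * ((((Λ0 * ra ^ m / rb ^ m) : ℕ) : ℝ) * ((8 : ℕ) : ℝ) - ((((u' * (Λ0 * ra ^ (m + 1) / rb ^ (m + 1)) / v') + ((qn * (Λ0 * ra ^ m / rb ^ m) / qd) - (u' * (Λ0 * ra ^ (m + 1) / rb ^ (m + 1)) / v')) : ℕ) : ℝ) - 1)) ^ 2 / (((((Λ0 * ra ^ m / rb ^ m) : ℕ) : ℝ) * ((8 : ℕ) : ℝ) - ((((u' * (Λ0 * ra ^ (m + 1) / rb ^ (m + 1)) / v') + ((qn * (Λ0 * ra ^ m / rb ^ m) / qd) - (u' * (Λ0 * ra ^ (m + 1) / rb ^ (m + 1)) / v')) : ℕ) : ℝ) - 1)) ^ 2 - ((v * (Λ0 * ra ^ (m + 1) / rb ^ (m + 1)) / 1 : ℕ) : ℝ) ^ 2) ^ 2 +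
                8 * (((v * (Λ0 * ra ^ (m + 1) / rb ^ (m + 1)) / 1 : ℕ) : ℝ) + 1 / 2) / (P.N j * (((((Λ0 * ra ^ m / rb ^ m) : ℕ) : ℝ) * ((8 : ℕ) : ℝ) - ((((u' * (Λ0 * ra ^ (m + 1) / rb ^ (m + 1)) / v') + ((qn * (Λ0 * ra ^ m / rb ^ m) / qd) - (u' * (Λ0 * ra ^ (m + 1) / rb ^ (m + 1)) / v')) : ℕ) : ℝ) - 1)) ^ 2 - (((v * (Λ0 * ra ^ (m + 1) / rb ^ (m + 1)) / 1 : ℕ) : ℝ) + 1 / 2) ^ 2))) *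
              ((Real.sqrt ((2 * (u' * (Λ0 * ra ^ (m + 1) / rb ^ (m + 1)) / v') + ((qn * (Λ0 * ra ^ m / rb ^ m) / qd) - (u' * (Λ0 * ra ^ (m + 1) / rb ^ (m + 1)) / v')) : ℕ) * ((((qn * (Λ0 * ra ^ m / rb ^ m) / qd) - (u' * (Λ0 * ra ^ (m + 1) / rb ^ (m + 1)) / v')) : ℕ) : ℝ)) / ((((qn * (Λ0 * ra ^ m / rb ^ m) / qd) - (u' * (Λ0 * ra ^ (m + 1) / rb ^ (m + 1)) / v')) : ℕ) : ℝ) * 1) ^ 2 / 2 + (Real.sqrt ((2 * (u' * (Λ0 * ra ^ (m + 1) / rb ^ (m + 1)) / v') + ((qn * (Λ0 * ra ^ m / rb ^ m) / qd) - (u' * (Λ0 * ra ^ (m + 1) / rb ^ (m + 1)) / v')) : ℕ) * ((((qn * (Λ0 * ra ^ m / rb ^ m) / qd) - (u' * (Λ0 * ra ^ (m + 1) / rb ^ (m + 1)) / v')) : ℕ) : ℝ)) / ((((qn * (Λ0 * ra ^ m / rb ^ m) / qd) - (u' * (Λ0 * ra ^ (m + 1) / rb ^ (m + 1)) / v'))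 : ℕ) : ℝ) * 1) ^ 2 / 2) ≤ A / π ^ 2 := by
    have e : ∑ m ∈ Finset.range Mb, (1 + εg) * ((P.N j : ℝ) ^ 2 / π ^ 2) *
              (8 * ((((Λ0 * ra ^ m / rb ^ m) : ℕ) : ℝ) * ((8 : ℕ) : ℝ) - ((((u' * (Λ0 * ra ^ (m + 1) / rb ^ (m + 1)) / v') + ((qn * (Λ0 * ra ^ m / rb ^ m) / qd) - (u' * (Λ0 * ra ^ (m + 1) / rb ^ (m + 1)) / v')) : ℕ) : ℝ) - 1)) ^ 2 / (((((Λ0 * ra ^ m / rb ^ m) : ℕ) : ℝ) * ((8 : ℕ) : ℝ) - ((((u' * (Λ0 * ra ^ (m + 1) / rb ^ (m + 1)) / v') + ((qn * (Λ0 * ra ^ m / rb ^ m) / qd) - (u' * (Λ0 * ra ^ (m + 1) / rb ^ (m + 1)) / v')) : ℕ) : ℝ) - 1)) ^ 2 - ((v * (Λ0 * ra ^ (m + 1) / rb ^ (m + 1)) / 1 : ℕ) : ℝ) ^ 2) ^ 2 +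
                8 * (((v * (Λ0 * ra ^ (m + 1) / rb ^ (m + 1)) / 1 : ℕ) : ℝ) + 1 / 2) / (P.N j * (((((Λ0 * ra ^ m / rb ^ m) : ℕ) : ℝ) * ((8 : ℕ) : ℝ) - ((((u' * (Λ0 * ra ^ (m + 1) / rb ^ (m + 1)) / v') + ((qn * (Λ0 * ra ^ m / rb ^ m) / qd) - (u' * (Λ0 * ra ^ (m + 1) / rb ^ (m + 1)) / v')) : ℕ) : ℝ) - 1)) ^ 2 - (((v * (Λ0 * ra ^ (m + 1) / rb ^ (m + 1)) / 1 : ℕ) : ℝ) + 1 / 2) ^ 2))) *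
              ((Real.sqrt ((2 * (u' * (Λ0 * ra ^ (m + 1) / rb ^ (m + 1)) / v') + ((qn * (Λ0 * ra ^ m / rb ^ m) / qd) - (u' * (Λ0 * ra ^ (m + 1) / rb ^ (m + 1)) / v')) : ℕ) * ((((qn * (Λ0 * ra ^ m / rb ^ m) / qd) - (u' * (Λ0 * ra ^ (m + 1) / rb ^ (m + 1)) / v')) : ℕ) : ℝ)) / ((((qn * (Λ0 * ra ^ m / rb ^ m) / qd) - (u' * (Λ0 * ra ^ (m + 1) / rb ^ (m + 1)) / v')) : ℕ) : ℝ) * 1) ^ 2 / 2 + (Real.sqrt ((2 * (u' * (Λ0 * ra ^ (m + 1) / rb ^ (m + 1)) / v') + ((qn * (Λ0 * ra ^ m / rb ^ m) / qd) - (u' * (Λ0 * ra ^ (m + 1) / rb ^ (m + 1)) / v')) : ℕ) * ((((qn * (Λ0 * ra ^ m / rb ^ m) / qd) - (u' * (Λ0 * ra ^ (m + 1) / rb ^ (m + 1)) / v')) : ℕ) : ℝ)) / ((((qn * (Λ0 * ra ^ m / rb ^ m) / qd) - (u' * (Λ0 * ra ^ (m + 1) / rb ^ (m + 1)) / v'))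 : ℕ) : ℝ) * 1) ^ 2 / 2) =
        (∑ m ∈ Finset.range Mb, (1 + εg) * (P.N j : ℝ) ^ 2 *
              (8 * ((((Λ0 * ra ^ m / rb ^ m) : ℕ) : ℝ) * ((8 : ℕ) : ℝ) - ((((u' * (Λ0 * ra ^ (m + 1) / rb ^ (m + 1)) / v') + ((qn * (Λ0 * ra ^ m / rb ^ m) / qd) - (u' * (Λ0 * ra ^ (m + 1) / rb ^ (m + 1)) / v')) : ℕ) : ℝ) - 1)) ^ 2 / (((((Λ0 * ra ^ m / rb ^ m) : ℕ) : ℝ) * ((8 : ℕ) : ℝ) - ((((u' * (Λ0 * ra ^ (m + 1) / rb ^ (m + 1)) / v') + ((qn * (Λ0 * ra ^ m / rb ^ m) / qd) - (u' * (Λ0 * ra ^ (m + 1) / rb ^ (m + 1)) / v')) : ℕ) : ℝ) - 1)) ^ 2 - ((v * (Λ0 * ra ^ (m + 1) / rb ^ (m + 1)) / 1 : ℕ) : ℝ) ^ 2) ^ 2 +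
                8 * (((v * (Λ0 * ra ^ (m + 1) / rb ^ (m + 1)) / 1 : ℕ) : ℝ) + 1 / 2) / (P.N j * (((((Λ0 * ra ^ m / rb ^ m) : ℕ) : ℝ) * ((8 : ℕ) : ℝ) - ((((u' * (Λ0 * ra ^ (m + 1) / rb ^ (m + 1)) / v') + ((qn * (Λ0 * ra ^ m / rb ^ m) / qd) - (u' * (Λ0 * ra ^ (m + 1) / rb ^ (m + 1)) / v')) : ℕ) : ℝ) - 1)) ^ 2 - (((v * (Λ0 * ra ^ (m + 1) / rb ^ (m + 1)) / 1 : ℕ) : ℝ) + 1 / 2) ^ 2))) *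
              ((2 * (u' * (Λ0 * ra ^ (m + 1) / rb ^ (m + 1)) / v') + ((qn * (Λ0 * ra ^ m / rb ^ m) / qd) - (u' * (Λ0 * ra ^ (m + 1) / rb ^ (m + 1)) / v')) : ℕ) / ((((qn * (Λ0 * ra ^ m / rb ^ m) / qd) - (u' * (Λ0 * ra ^ (m + 1) / rb ^ (m + 1)) / v')) : ℕ) : ℝ))) / π ^ 2 := by
      rw [Finset.sum_div]
      refine Finset.sum_congr rfl fun m _ => ?_
      exact ctg_main_term_eq _ _ _ _ _ _ (Nat.cast_nonneg _) (hbpos m)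
    rw [e]
    exact div_le_div_of_nonneg_right hA hπ.le
  have hβ₀ : ∀ m ∈ Finset.range Mb, (1 + εg⁻¹) * ((P.N j : ℝ) ^ 2 / π ^ 2) * (4 / ((((Λ0 * ra ^ m / rb ^ m) * 8 - v * (Λ0 * ra ^ (m + 1) / rb ^ (m + 1)) / 1 - ((u' * (Λ0 * ra ^ (m + 1) / rb ^ (m + 1)) / v') + ((qn * (Λ0 * ra ^ m / rb ^ m) / qd) - (u' * (Λ0 * ra ^ (m + 1) / rb ^ (m + 1)) / v'))) : ℕ) : ℝ)) ^ 2 *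
              (1 / (((((Λ0 * ra ^ m / rb ^ m) * 8 - v * (Λ0 * ra ^ (m + 1) / rb ^ (m + 1)) / 1 - ((u' * (Λ0 * ra ^ (m + 1) / rb ^ (m + 1)) / v') + ((qn * (Λ0 * ra ^ m / rb ^ m) / qd) - (u' * (Λ0 * ra ^ (m + 1) / rb ^ (m + 1)) / v'))) : ℕ) : ℝ)) + (((u' * (Λ0 * ra ^ (m + 1) / rb ^ (m + 1)) / v') + ((qn * (Λ0 * ra ^ m / rb ^ m) / qd) - (u' * (Λ0 * ra ^ (m + 1) / rb ^ (m + 1)) / v')) : ℕ) : ℝ)) ^ (2 * po) +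
                1 / (P.N j * (((((Λ0 * ra ^ m / rb ^ m) * 8 - v * (Λ0 * ra ^ (m + 1) / rb ^ (m + 1)) / 1 - ((u' * (Λ0 * ra ^ (m + 1) / rb ^ (m + 1)) / v') + ((qn * (Λ0 * ra ^ m / rb ^ m) / qd) - (u' * (Λ0 * ra ^ (m + 1) / rb ^ (m + 1)) / v'))) : ℕ) : ℝ)) + (((u' * (Λ0 * ra ^ (m + 1) / rb ^ (m + 1)) / v') + ((qn * (Λ0 * ra ^ m / rb ^ m) / qd) - (u' * (Λ0 * ra ^ (m + 1) / rb ^ (m + 1)) / v')) : ℕ) : ℝ)) ^ (2 * po - 1)))) *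
              ((2 * (((u' * (Λ0 * ra ^ (m + 1) / rb ^ (m + 1)) / v') + ((qn * (Λ0 * ra ^ m / rb ^ m) / qd) - (u' * (Λ0 * ra ^ (m + 1) / rb ^ (m + 1)) / v')) : ℕ) : ℝ) / P.N j + 1) * (((u' * (Λ0 * ra ^ (m + 1) / rb ^ (m + 1)) / v') + ((qn * (Λ0 * ra ^ m / rb ^ m) / qd) - (u' * (Λ0 * ra ^ (m + 1) / rb ^ (m + 1)) / v')) : ℕ) : ℝ) ^ (2 * po)) ≤ βs / π ^ 2 := fun m hm => ctg_rem_term_le hπ (hβ m hm)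
  have hρ₀ : ∀ m ∈ Finset.range Mb, (π * (((Λ0 * ra ^ (m + 1) / rb ^ (m + 1)) * 8 : ℕ) : ℝ) * (2 : ℝ)⁻¹ ^ 70 / P.N j) ^ 2 ≤ ρs := fun m hm => by
    have hle := (Nat.mul_le_mul_right 8 (geom_blocks_monotone hrb hrab.le Λ0 (Finset.mem_range.mp hm)) : (Λ0 * ra ^ (m + 1) / rb ^ (m + 1)) * 8 ≤ (Λ0 * ra ^ Mb / rb ^ Mb) * 8)
    exact ctg_round_le (Nat.cast_nonneg _) (by exact_mod_cast hle) (by positivity) hN hρ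
  have hZ₀ : ∑ m ∈ Finset.range Mb, 8 * 10 * P.δ j / π * ((Real.sqrt ((2 * (u' * (Λ0 * ra ^ (m + 1) / rb ^ (m + 1)) / v') + ((qn * (Λ0 * ra ^ m / rb ^ m) / qd) - (u' * (Λ0 * ra ^ (m + 1) / rb ^ (m + 1)) / v')) : ℕ) * ((((qn * (Λ0 * ra ^ m / rb ^ m) / qd) - (u' * (Λ0 * ra ^ (m + 1) / rb ^ (m + 1)) / v')) : ℕ) : ℝ)) / ((((qn * (Λ0 * ra ^ m / rb ^ m) / qd) - (u' * (Λ0 * ra ^ (m + 1) / rb ^ (m + 1)) / v')) : ℕ) : ℝ) * 1) ^ 2 / 2 +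
        (Real.sqrt ((2 * (u' * (Λ0 * ra ^ (m + 1) / rb ^ (m + 1)) / v') + ((qn * (Λ0 * ra ^ m / rb ^ m) / qd) - (u' * (Λ0 * ra ^ (m + 1) / rb ^ (m + 1)) / v')) : ℕ) * ((((qn * (Λ0 * ra ^ m / rb ^ m) / qd) - (u' * (Λ0 * ra ^ (m + 1) / rb ^ (m + 1)) / v')) : ℕ) : ℝ)) / ((((qn * (Λ0 * ra ^ m / rb ^ m) / qd) - (u' * (Λ0 * ra ^ (m + 1) / rb ^ (m + 1)) / v')) : ℕ) : ℝ) * 1) ^ 2 / 2) ≤ Z :=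
    (Finset.sum_le_sum fun m _ => ctg_zone_term_le hδ0 hδs (Nat.cast_nonneg _) (hbpos m)).trans hZ
  have h := ratioClass_vstep_geomExplicitCTG_le P hγ' hδ₀ hd' hN₀' hρN' a b has h0 hb hab j hv Λ0 hrb hrab hΛ0 Mb hqd hΛX hv' hslope hbase hQ2 hgap hgapc hp hεg hM hMδ hε hY (div_nonneg hβs hπ.le) hρs hA₀ hβ₀ hρ₀ hZ₀
  simpa only [pow_zero, Nat.mul_one, Nat.div_one, Nat.cast_one] using h


set_option maxHeartbeats 800000 in
/-- **RATIO CLASS, H-STEP, IN CT-GEO GRADE, GEOMETRIC BLOCKS** ((C-H)/(B-H) with `v = 3`: `C_j(Λ₀) ≤ (w + √A_j(Y))² + far`): `…GeomRatioExplicitCTG.ratioClass_hstep_geomExplicitCTG_le` at the crux point, block sums normalised as in `lowFibre_hstep_ctg_le`. [cite: Grafakos2014, Prop. 3.1.2 (5), Prop. 3.2.7 (3)] -/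
theorem ratio_hstep_ctg_le (hγ : P.γ = 8) (hδ₀ : 0 < P.δ₀) (hd : P.d = 2) (hN₀ : P.N₀ = 1) (hρN : P.ρN = 2)
    (a b : ℕ → UnitAddTorus (Fin 2) → ℝ) (has : ∀ j, IsSmooth (a j)) (h0 : a 0 = datum)
    (hb : ∀ j, b j = a j ∘ shearMap 0 1 (amp ⟨P.U j, P.U_periodic j, P.contDiff_U (P.δ_pos hδ₀ (by rw [hd]; norm_num) j)⟩ P.γ))
    (hab : ∀ j, a (j + 1) = b j ∘ shearMap 1 0 (amp ⟨P.U j, P.U_periodic j, P.contDiff_U (P.δ_pos hδ₀ (by rw [hd]; norm_num) j)⟩ P.γ))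
    (j : ℕ) {v : ℕ} (hv : 0 < v)
    {ra rb qn qd : ℕ} (Λ0 : ℕ) (hrb : 0 < rb) (hrab : rb < ra) (hΛ0 : 2 ≤ Λ0) (Mb : ℕ) (hqd : 0 < qd)
    {u' v' : ℕ} (hv' : 0 < v') (hslope : ra * qd * u' ≤ rb * v' * qn)
    (hbase : qd * (u' * (ra - 1) + rb * v') + ra * qd * u' * Λ0 ≤ rb * v' * qn * Λ0) (hQ2 : 2 * qd ≤ qn * Λ0)
    (hgap : v * (ra - 1) * qd + rb * qd + (v * ra * qd + qn * rb) * Λ0 ≤ 8 * rb * qd * Λ0) (hgapc : v * ra * qd + qn * rb ≤ 8 * rb * qd)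
    {po : ℕ} (hp : 1 ≤ po) {εg : ℝ} (hεg : 0 < εg)
    (hMδ : 10 * P.δ j < π / 2) {δs : ℝ} (hδs : P.δ j ≤ δs)
    {Y : ℕ} (hY : Y ≤ Λ0)
    {A βs ρs Z : ℝ} (hβs : 0 ≤ βs) (hρs : 0 ≤ ρs)
    (hA : ∑ m ∈ Finset.range Mb, (1 + εg) * (P.N j : ℝ) ^ 2 *
              (8 * ((((Λ0 * ra ^ m / rb ^ m) : ℕ) : ℝ) * ((8 : ℕ) : ℝ) - ((((u' * (Λ0 * ra ^ (m + 1) / rb ^ (m + 1)) / v') + ((qn * (Λ0 * ra ^ m / rb ^ m) / qd) - (u' * (Λ0 * ra ^ (m + 1) / rb ^ (m + 1)) / v')) : ℕ) : ℝ) - 1)) ^ 2 / (((((Λ0 * ra ^ m / rb ^ m) : ℕ) : ℝ) * ((8 : ℕ) : ℝ) - ((((u' * (Λ0 * ra ^ (m + 1) / rb ^ (m + 1)) / v') + ((qn * (Λ0 * ra ^ m / rb ^ m) / qd) - (u' * (Λ0 * ra ^ (m + 1) / rb ^ (m + 1)) / v')) : ℕ) : ℝ) - 1)) ^ 2 - ((v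 * (Λ0 * ra ^ (m + 1) / rb ^ (m + 1)) / 1 : ℕ) : ℝ) ^ 2) ^ 2 +
                8 * (((v * (Λ0 * ra ^ (m + 1) / rb ^ (m + 1)) / 1 : ℕ) : ℝ) + 1 / 2) / (P.N j * (((((Λ0 * ra ^ m / rb ^ m) : ℕ) : ℝ) * ((8 : ℕ) : ℝ) - ((((u' * (Λ0 * ra ^ (m + 1) / rb ^ (m + 1)) / v') + ((qn * (Λ0 * ra ^ m / rb ^ m) / qd) - (u' * (Λ0 * ra ^ (m + 1) / rb ^ (m + 1)) / v')) : ℕ) : ℝ) - 1)) ^ 2 - (((v * (Λ0 * ra ^ (m + 1) / rb ^ (m + 1)) / 1 : ℕ) : ℝ) + 1 / 2) ^ 2))) *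
              ((2 * (u' * (Λ0 * ra ^ (m + 1) / rb ^ (m + 1)) / v') + ((qn * (Λ0 * ra ^ m / rb ^ m) / qd) - (u' * (Λ0 * ra ^ (m + 1) / rb ^ (m + 1)) / v')) : ℕ) / ((((qn * (Λ0 * ra ^ m / rb ^ m) / qd) - (u' * (Λ0 * ra ^ (m + 1) / rb ^ (m + 1)) / v')) : ℕ) : ℝ)) ≤ A)
    (hβ : ∀ m ∈ Finset.range Mb, (1 + εg⁻¹) * (P.N j : ℝ) ^ 2 * (4 / ((((Λ0 * ra ^ m / rb ^ m) * 8 - v * (Λ0 * ra ^ (m + 1) / rb ^ (m + 1)) / 1 - ((u' * (Λ0 * ra ^ (m + 1) / rb ^ (m + 1)) / v') + ((qn * (Λ0 * ra ^ m / rb ^ m) / qd) - (u' * (Λ0 * ra ^ (m + 1) / rb ^ (m + 1)) / v'))) : ℕ) : ℝ)) ^ 2 *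
              (1 / (((((Λ0 * ra ^ m / rb ^ m) * 8 - v * (Λ0 * ra ^ (m + 1) / rb ^ (m + 1)) / 1 - ((u' * (Λ0 * ra ^ (m + 1) / rb ^ (m + 1)) / v') + ((qn * (Λ0 * ra ^ m / rb ^ m) / qd) - (u' * (Λ0 * ra ^ (m + 1) / rb ^ (m + 1)) / v'))) : ℕ) : ℝ)) + (((u' * (Λ0 * ra ^ (m + 1) / rb ^ (m + 1)) / v') + ((qn * (Λ0 * ra ^ m / rb ^ m) / qd) - (u' * (Λ0 * ra ^ (m + 1) / rb ^ (m + 1)) / v')) : ℕ) : ℝ)) ^ (2 * po) +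
                1 / (P.N j * (((((Λ0 * ra ^ m / rb ^ m) * 8 - v * (Λ0 * ra ^ (m + 1) / rb ^ (m + 1)) / 1 - ((u' * (Λ0 * ra ^ (m + 1) / rb ^ (m + 1)) / v') + ((qn * (Λ0 * ra ^ m / rb ^ m) / qd) - (u' * (Λ0 * ra ^ (m + 1) / rb ^ (m + 1)) / v'))) : ℕ) : ℝ)) + (((u' * (Λ0 * ra ^ (m + 1) / rb ^ (m + 1)) / v') + ((qn * (Λ0 * ra ^ m / rb ^ m) / qd) - (u' * (Λ0 * ra ^ (m + 1) / rb ^ (m + 1)) / v')) : ℕ) : ℝ)) ^ (2 * po - 1)))) *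
              ((2 * (((u' * (Λ0 * ra ^ (m + 1) / rb ^ (m + 1)) / v') + ((qn * (Λ0 * ra ^ m / rb ^ m) / qd) - (u' * (Λ0 * ra ^ (m + 1) / rb ^ (m + 1)) / v')) : ℕ) : ℝ) / P.N j + 1) * (((u' * (Λ0 * ra ^ (m + 1) / rb ^ (m + 1)) / v') + ((qn * (Λ0 * ra ^ m / rb ^ m) / qd) - (u' * (Λ0 * ra ^ (m + 1) / rb ^ (m + 1)) / v')) : ℕ) : ℝ) ^ (2 * po)) ≤ βs)
    (hρ : 16 * ((((Λ0 * ra ^ Mb / rb ^ Mb) * 8 : ℕ) : ℝ) * ((2 : ℝ)⁻¹ ^ 70) / P.N j) ^ 2 ≤ ρs)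
    (hZ : ∑ m ∈ Finset.range Mb, 27 * δs * ((2 * (u' * (Λ0 * ra ^ (m + 1) / rb ^ (m + 1)) / v') + ((qn * (Λ0 * ra ^ m / rb ^ m) / qd) - (u' * (Λ0 * ra ^ (m + 1) / rb ^ (m + 1)) / v')) : ℕ) / ((((qn * (Λ0 * ra ^ m / rb ^ m) / qd) - (u' * (Λ0 * ra ^ (m + 1) / rb ^ (m + 1)) / v')) : ℕ) : ℝ)) ≤ Z) :
    ∑' k : Fin 2 → ℤ, (if (Λ0 : ℤ) ≤ |k 0| ∧ (((1 : ℕ)) : ℤ) * |k 1| ≤ (v : ℤ) * |k 0| then (1 : ℝ) else 0) *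
        ‖mFourierCoeff (fun x => (b j x : ℂ)) k‖ ^ 2 ≤
      (Real.sqrt (A / π ^ 2 + βs / π ^ 2 / 2) + Real.sqrt (ρs / 2 + Z) +
          Real.sqrt (∑' k : Fin 2 → ℤ, (if (Y : ℤ) ≤ |k 0| ∧ (u' : ℤ) * |k 0| ≤ (v' : ℤ) * |k 1| then (1 : ℝ) else 0) *
            ‖mFourierCoeff (fun x => (a j x : ℂ)) k‖ ^ 2)) ^ 2 +
        ((1 + P.γ) ^ (2 * j) / ((Λ0 * ra ^ Mb / rb ^ Mb : ℕ) : ℝ)) ^ 2  := by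
  have hγ' : P.γ = ((8 : ℕ) : ℝ) := by rw [hγ]; norm_num
  have hd' : 0 < P.d := by rw [hd]; norm_num
  have hN₀' : 1 ≤ P.N₀ := by rw [hN₀]
  have hρN' : 1 ≤ P.ρN := by rw [hρN]; norm_num
  have hε : Real.exp (-((10 : ℝ) ^ 2 / 2)) ≤ (2 : ℝ)⁻¹ ^ 70 := exp_neg_sq_half_ten_le
  have hM : (1 : ℝ) ≤ 10 := by norm_num
  have hN : (0 : ℝ) < P.N j := by rw [K1Ledger.N_cast_eq P hN₀ hρN]; positivity
  have hπ : (0 : ℝ) < π ^ 2 := by positivity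
  have hδ0 : 0 ≤ P.δ j := (P.δ_pos hδ₀ hd' j).le
  have hbpos : ∀ m : ℕ, (0 : ℝ) < ((((qn * (Λ0 * ra ^ m / rb ^ m) / qd) - (u' * (Λ0 * ra ^ (m + 1) / rb ^ (m + 1)) / v')) : ℕ) : ℝ) := fun m => Nat.cast_pos.mpr (Nat.sub_pos_of_lt (geom_sep hrb hv' hqd (geom_blocks_succ_le hrb (by omega) Λ0 m) (geom_blocks_ge hrb hrab.le Λ0 m) hslope hbase))
  have hA₀ : ∑ m ∈ Finset.range Mb, (1 + εg) * ((P.N j : ℝ) ^ 2 / π ^ 2) *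
              (8 * ((((Λ0 * ra ^ m / rb ^ m) : ℕ) : ℝ) * ((8 : ℕ) : ℝ) - ((((u' * (Λ0 * ra ^ (m + 1) / rb ^ (m + 1)) / v') + ((qn * (Λ0 * ra ^ m / rb ^ m) / qd) - (u' * (Λ0 * ra ^ (m + 1) / rb ^ (m + 1)) / v')) : ℕ) : ℝ) - 1)) ^ 2 / (((((Λ0 * ra ^ m / rb ^ m) : ℕ) : ℝ) * ((8 : ℕ) : ℝ) - ((((u' * (Λ0 * ra ^ (m + 1) / rb ^ (m + 1)) / v') + ((qn * (Λ0 * ra ^ m / rb ^ m) / qd) - (u' * (Λ0 * ra ^ (m + 1) / rb ^ (m + 1)) / v')) : ℕ) : ℝ) - 1)) ^ 2 - ((v * (Λ0 * ra ^ (m + 1) / rb ^ (m + 1)) / 1 : ℕ) : ℝ) ^ 2) ^ 2 +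
                8 * (((v * (Λ0 * ra ^ (m + 1) / rb ^ (m + 1)) / 1 : ℕ) : ℝ) + 1 / 2) / (P.N j * (((((Λ0 * ra ^ m / rb ^ m) : ℕ) : ℝ) * ((8 : ℕ) : ℝ) - ((((u' * (Λ0 * ra ^ (m + 1) / rb ^ (m + 1)) / v') + ((qn * (Λ0 * ra ^ m / rb ^ m) / qd) - (u' * (Λ0 * ra ^ (m + 1) / rb ^ (m + 1)) / v')) : ℕ) : ℝ) - 1)) ^ 2 - (((v * (Λ0 * ra ^ (m + 1) / rb ^ (m + 1)) / 1 : ℕ) : ℝ) + 1 / 2) ^ 2))) *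
              ((Real.sqrt ((2 * (u' * (Λ0 * ra ^ (m + 1) / rb ^ (m + 1)) / v') + ((qn * (Λ0 * ra ^ m / rb ^ m) / qd) - (u' * (Λ0 * ra ^ (m + 1) / rb ^ (m + 1)) / v')) : ℕ) * ((((qn * (Λ0 * ra ^ m / rb ^ m) / qd) - (u' * (Λ0 * ra ^ (m + 1) / rb ^ (m + 1)) / v')) : ℕ) : ℝ)) / ((((qn * (Λ0 * ra ^ m / rb ^ m) / qd) - (u' * (Λ0 * ra ^ (m + 1) / rb ^ (m + 1)) / v')) : ℕ) : ℝ) * 1) ^ 2 / 2 + (Real.sqrt ((2 * (u' * (Λ0 * ra ^ (m + 1) / rb ^ (m + 1)) / v') + ((qn * (Λ0 * ra ^ m / rb ^ m) / qd) - (u' * (Λ0 * ra ^ (m + 1) / rb ^ (m + 1)) / v')) : ℕ) * ((((qn * (Λ0 * ra ^ m / rb ^ m) / qd) - (u' * (Λ0 * ra ^ (m + 1) / rb ^ (m + 1)) / v')) : ℕ) : ℝ)) / ((((qn * (Λ0 * ra ^ m / rb ^ m) / qd) - (u' * (Λ0 * ra ^ (m + 1) / rb ^ (m + 1)) / v'))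 : ℕ) : ℝ) * 1) ^ 2 / 2) ≤ A / π ^ 2 := by
    have e : ∑ m ∈ Finset.range Mb, (1 + εg) * ((P.N j : ℝ) ^ 2 / π ^ 2) *
              (8 * ((((Λ0 * ra ^ m / rb ^ m) : ℕ) : ℝ) * ((8 : ℕ) : ℝ) - ((((u' * (Λ0 * ra ^ (m + 1) / rb ^ (m + 1)) / v') + ((qn * (Λ0 * ra ^ m / rb ^ m) / qd) - (u' * (Λ0 * ra ^ (m + 1) / rb ^ (m + 1)) / v')) : ℕ) : ℝ) - 1)) ^ 2 / (((((Λ0 * ra ^ m / rb ^ m) : ℕ) : ℝ) * ((8 : ℕ) : ℝ) - ((((u' * (Λ0 * ra ^ (m + 1) / rb ^ (m + 1)) / v') + ((qn * (Λ0 * ra ^ m / rb ^ m) / qd) - (u' * (Λ0 * ra ^ (m + 1) / rb ^ (m + 1)) / v')) : ℕ) : ℝ) - 1)) ^ 2 - ((v * (Λ0 * ra ^ (m + 1) / rb ^ (m + 1)) / 1 : ℕ) : ℝ) ^ 2) ^ 2 +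
                8 * (((v * (Λ0 * ra ^ (m + 1) / rb ^ (m + 1)) / 1 : ℕ) : ℝ) + 1 / 2) / (P.N j * (((((Λ0 * ra ^ m / rb ^ m) : ℕ) : ℝ) * ((8 : ℕ) : ℝ) - ((((u' * (Λ0 * ra ^ (m + 1) / rb ^ (m + 1)) / v') + ((qn * (Λ0 * ra ^ m / rb ^ m) / qd) - (u' * (Λ0 * ra ^ (m + 1) / rb ^ (m + 1)) / v')) : ℕ) : ℝ) - 1)) ^ 2 - (((v * (Λ0 * ra ^ (m + 1) / rb ^ (m + 1)) / 1 : ℕ) : ℝ) + 1 / 2) ^ 2))) *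
              ((Real.sqrt ((2 * (u' * (Λ0 * ra ^ (m + 1) / rb ^ (m + 1)) / v') + ((qn * (Λ0 * ra ^ m / rb ^ m) / qd) - (u' * (Λ0 * ra ^ (m + 1) / rb ^ (m + 1)) / v')) : ℕ) * ((((qn * (Λ0 * ra ^ m / rb ^ m) / qd) - (u' * (Λ0 * ra ^ (m + 1) / rb ^ (m + 1)) / v')) : ℕ) : ℝ)) / ((((qn * (Λ0 * ra ^ m / rb ^ m) / qd) - (u' * (Λ0 * ra ^ (m + 1) / rb ^ (m + 1)) / v')) : ℕ) : ℝ) * 1) ^ 2 / 2 + (Real.sqrt ((2 * (u' * (Λ0 * ra ^ (m + 1) / rb ^ (m + 1)) / v') + ((qn * (Λ0 * ra ^ m / rb ^ m) / qd) - (u' * (Λ0 * ra ^ (m + 1) / rb ^ (m + 1)) / v')) : ℕ) * ((((qn * (Λ0 * ra ^ m / rb ^ m) / qd) - (u' * (Λ0 * ra ^ (m + 1) / rb ^ (m + 1)) / v')) : ℕ) : ℝ)) / ((((qn * (Λ0 * ra ^ m / rb ^ m) / qd) - (u' * (Λ0 * ra ^ (m + 1) / rb ^ (m + 1)) / v'))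 : ℕ) : ℝ) * 1) ^ 2 / 2) =
        (∑ m ∈ Finset.range Mb, (1 + εg) * (P.N j : ℝ) ^ 2 *
              (8 * ((((Λ0 * ra ^ m / rb ^ m) : ℕ) : ℝ) * ((8 : ℕ) : ℝ) - ((((u' * (Λ0 * ra ^ (m + 1) / rb ^ (m + 1)) / v') + ((qn * (Λ0 * ra ^ m / rb ^ m) / qd) - (u' * (Λ0 * ra ^ (m + 1) / rb ^ (m + 1)) / v')) : ℕ) : ℝ) - 1)) ^ 2 / (((((Λ0 * ra ^ m / rb ^ m) : ℕ) : ℝ) * ((8 : ℕ) : ℝ) - ((((u' * (Λ0 * ra ^ (m + 1) / rb ^ (m + 1)) / v') + ((qn * (Λ0 * ra ^ m / rb ^ m) / qd) - (u' * (Λ0 * ra ^ (m + 1) / rb ^ (m + 1)) / v')) : ℕ) : ℝ) - 1)) ^ 2 - ((v * (Λ0 * ra ^ (m + 1) / rb ^ (m + 1)) / 1 : ℕ) : ℝ) ^ 2) ^ 2 +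
                8 * (((v * (Λ0 * ra ^ (m + 1) / rb ^ (m + 1)) / 1 : ℕ) : ℝ) + 1 / 2) / (P.N j * (((((Λ0 * ra ^ m / rb ^ m) : ℕ) : ℝ) * ((8 : ℕ) : ℝ) - ((((u' * (Λ0 * ra ^ (m + 1) / rb ^ (m + 1)) / v') + ((qn * (Λ0 * ra ^ m / rb ^ m) / qd) - (u' * (Λ0 * ra ^ (m + 1) / rb ^ (m + 1)) / v')) : ℕ) : ℝ) - 1)) ^ 2 - (((v * (Λ0 * ra ^ (m + 1) / rb ^ (m + 1)) / 1 : ℕ) : ℝ) + 1 / 2) ^ 2))) *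
              ((2 * (u' * (Λ0 * ra ^ (m + 1) / rb ^ (m + 1)) / v') + ((qn * (Λ0 * ra ^ m / rb ^ m) / qd) - (u' * (Λ0 * ra ^ (m + 1) / rb ^ (m + 1)) / v')) : ℕ) / ((((qn * (Λ0 * ra ^ m / rb ^ m) / qd) - (u' * (Λ0 * ra ^ (m + 1) / rb ^ (m + 1)) / v')) : ℕ) : ℝ))) / π ^ 2 := by
      rw [Finset.sum_div]
      refine Finset.sum_congr rfl fun m _ => ?_
      exact ctg_main_term_eq _ _ _ _ _ _ (Nat.cast_nonneg _) (hbpos m)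
    rw [e]
    exact div_le_div_of_nonneg_right hA hπ.le
  have hβ₀ : ∀ m ∈ Finset.range Mb, (1 + εg⁻¹) * ((P.N j : ℝ) ^ 2 / π ^ 2) * (4 / ((((Λ0 * ra ^ m / rb ^ m) * 8 - v * (Λ0 * ra ^ (m + 1) / rb ^ (m + 1)) / 1 - ((u' * (Λ0 * ra ^ (m + 1) / rb ^ (m + 1)) / v') + ((qn * (Λ0 * ra ^ m / rb ^ m) / qd) - (u' * (Λ0 * ra ^ (m + 1) / rb ^ (m + 1)) / v'))) : ℕ) : ℝ)) ^ 2 *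
              (1 / (((((Λ0 * ra ^ m / rb ^ m) * 8 - v * (Λ0 * ra ^ (m + 1) / rb ^ (m + 1)) / 1 - ((u' * (Λ0 * ra ^ (m + 1) / rb ^ (m + 1)) / v') + ((qn * (Λ0 * ra ^ m / rb ^ m) / qd) - (u' * (Λ0 * ra ^ (m + 1) / rb ^ (m + 1)) / v'))) : ℕ) : ℝ)) + (((u' * (Λ0 * ra ^ (m + 1) / rb ^ (m + 1)) / v') + ((qn * (Λ0 * ra ^ m / rb ^ m) / qd) - (u' * (Λ0 * ra ^ (m + 1) / rb ^ (m + 1)) / v')) : ℕ) : ℝ)) ^ (2 * po) +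
                1 / (P.N j * (((((Λ0 * ra ^ m / rb ^ m) * 8 - v * (Λ0 * ra ^ (m + 1) / rb ^ (m + 1)) / 1 - ((u' * (Λ0 * ra ^ (m + 1) / rb ^ (m + 1)) / v') + ((qn * (Λ0 * ra ^ m / rb ^ m) / qd) - (u' * (Λ0 * ra ^ (m + 1) / rb ^ (m + 1)) / v'))) : ℕ) : ℝ)) + (((u' * (Λ0 * ra ^ (m + 1) / rb ^ (m + 1)) / v') + ((qn * (Λ0 * ra ^ m / rb ^ m) / qd) - (u' * (Λ0 * ra ^ (m + 1) / rb ^ (m + 1)) / v')) : ℕ) : ℝ)) ^ (2 * po - 1)))) *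
              ((2 * (((u' * (Λ0 * ra ^ (m + 1) / rb ^ (m + 1)) / v') + ((qn * (Λ0 * ra ^ m / rb ^ m) / qd) - (u' * (Λ0 * ra ^ (m + 1) / rb ^ (m + 1)) / v')) : ℕ) : ℝ) / P.N j + 1) * (((u' * (Λ0 * ra ^ (m + 1) / rb ^ (m + 1)) / v') + ((qn * (Λ0 * ra ^ m / rb ^ m) / qd) - (u' * (Λ0 * ra ^ (m + 1) / rb ^ (m + 1)) / v')) : ℕ) : ℝ) ^ (2 * po)) ≤ βs / π ^ 2 := fun m hm => ctg_rem_term_le hπ (hβ m hm)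
  have hρ₀ : ∀ m ∈ Finset.range Mb, (π * (((Λ0 * ra ^ (m + 1) / rb ^ (m + 1)) * 8 : ℕ) : ℝ) * (2 : ℝ)⁻¹ ^ 70 / P.N j) ^ 2 ≤ ρs := fun m hm => by
    have hle := (Nat.mul_le_mul_right 8 (geom_blocks_monotone hrb hrab.le Λ0 (Finset.mem_range.mp hm)) : (Λ0 * ra ^ (m + 1) / rb ^ (m + 1)) * 8 ≤ (Λ0 * ra ^ Mb / rb ^ Mb) * 8)
    exact ctg_round_le (Nat.cast_nonneg _) (by exact_mod_cast hle) (by positivity) hN hρ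
  have hZ₀ : ∑ m ∈ Finset.range Mb, 8 * 10 * P.δ j / π * ((Real.sqrt ((2 * (u' * (Λ0 * ra ^ (m + 1) / rb ^ (m + 1)) / v') + ((qn * (Λ0 * ra ^ m / rb ^ m) / qd) - (u' * (Λ0 * ra ^ (m + 1) / rb ^ (m + 1)) / v')) : ℕ) * ((((qn * (Λ0 * ra ^ m / rb ^ m) / qd) - (u' * (Λ0 * ra ^ (m + 1) / rb ^ (m + 1)) / v')) : ℕ) : ℝ)) / ((((qn * (Λ0 * ra ^ m / rb ^ m) / qd) - (u' * (Λ0 * ra ^ (m + 1) / rb ^ (m + 1)) / v')) : ℕ) : ℝ) * 1) ^ 2 / 2 +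
        (Real.sqrt ((2 * (u' * (Λ0 * ra ^ (m + 1) / rb ^ (m + 1)) / v') + ((qn * (Λ0 * ra ^ m / rb ^ m) / qd) - (u' * (Λ0 * ra ^ (m + 1) / rb ^ (m + 1)) / v')) : ℕ) * ((((qn * (Λ0 * ra ^ m / rb ^ m) / qd) - (u' * (Λ0 * ra ^ (m + 1) / rb ^ (m + 1)) / v')) : ℕ) : ℝ)) / ((((qn * (Λ0 * ra ^ m / rb ^ m) / qd) - (u' * (Λ0 * ra ^ (m + 1) / rb ^ (m + 1)) / v')) : ℕ) : ℝ) * 1) ^ 2 / 2) ≤ Z :=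
    (Finset.sum_le_sum fun m _ => ctg_zone_term_le hδ0 hδs (Nat.cast_nonneg _) (hbpos m)).trans hZ
  have h := ratioClass_hstep_geomExplicitCTG_le P hγ' hδ₀ hd' hN₀' hρN' a b has h0 hb hab j hv Λ0 hrb hrab hΛ0 Mb hqd hv' hslope hbase hQ2 hgap hgapc hp hεg hM hMδ hε hY (div_nonneg hβs hπ.le) hρs hA₀ hβ₀ hρ₀ hZ₀
  simpa only [pow_zero, Nat.mul_one, Nat.div_one, Nat.cast_one] using h


end Cascade

end Summit.AnomalousDissipation.AnomalousDissipation.Theorems.SawtoothPulseCascade.K1Window
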